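import Summits.Ventures.CertifiedManyBodySolver.Theorems.M3x2EdgeSplitSymReplayBoxCanon
import Summits.Ventures.CertifiedManyBodySolver.Theorems.M3x2EdgeSplitSymReplayNormalWords
import Literature.Computability.FineGrained.NegativeTriangleToRadiusProgram
import HarnessLib

/-!
# SymReplay checker — E4(b) PACKED NORMAL-FORM / COLLECTOR TWIN, part 1: executables and the letter-code order isomorphism

(team lb-sym, cell hub-lb; engine item «E4 bridge» (crit-1 V154) for the Lean-replay COST of stmt-Ventures-22024's
E-class certificate; executable definitions = hub-lb-sym-plan-1's spec `Cruxes/LowerEdge_ge_m83o100/E4Spec_symplan1.lean`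
§(a)(b) verbatim, which are hub-lb-sym-ref-1's `engine/H_base.lean` (b) packing; lemmas by hub-lb-sym-eng-4 g2.)

WHAT.  Inside an integer box `[lo.1, hi.1] × [lo.2, hi.2]` a ladder letter becomes ONE natural number
`encL lo hi ℓ = 4·rank(ℓ.x) + 2·spin + (1 − dag)`, `rank x = (x 0 − lo.1)·W + (x 1 − lo.2)`, `W = hi.2 − lo.2 + 1`,
so that the tree's `Letter.blt` IS `<` on `ℕ`, `Letter.beq` IS `==`, `Letter.modeEq/modeLt` are «equal / smaller halves» and
`Letter.dag` is «even».  The packed normal-orderer `pinsL/pnfWord`, the packed collector `pcollect2` (fuel-structural merge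
sort + adjacent merge) and `pdropZeros/pisZero` are the tree's `insL/nfWord/collect/dropZeros/isZero` with these `ℕ`
comparisons — no `Fin 2 → ℤ` closure is touched in the hot loop (hub-lb-sym-ref-1 measured nf ×2.4, gen+nf+collect ×6
interpreted, STATUS 2026-08-28 l.1800/l.1810).

CONTENTS.  (a) codes `boxW/siteRank/encL/encW/encP`; (b) packed executables `pdag/pmodeEq/pmodeLt/pwordEq/pwordLt/pconsNeg/
pinsL/pnfWord/ppscale/pnfPoly/pmergeF/pmergePairs/pmergeAll/psortW/pmergeAdj/pcollect2/pdropZeros/pisZero`; (c) THE ORDER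
ISOMORPHISM (standard axioms, no `native_decide`): `mixedRadix_lt` (+ the landed `NegTriToRadius.mul_add_eq_iff`), `siteRank_lt_iff/eq_iff`, `pdag_encL`,
`pmodeEq_encL`, `pmodeLt_encL`, `beq_encL`, `blt_encL : decide (encL a < encL b) = a.blt b` for letters in the box.
Part 2 (`…SymReplayPackedNFBridge`) lifts these to `pinsL/pnfWord/wordEq/wordLt/mergeF/…/collect/isZero` agreement.

HONEST FRAMING: refinement lemmas between two executables (a checker COST lever); no certificate lands by this file; no bound
of record moves; no summit or crux statement is proved here; nothing here predicts superconductivity.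
-/

namespace Summit.Ventures.CertifiedManyBodySolver.Theorems.SymReplay.PackedNF

open Literature.Probability.LatticeModels (Site)
open Literature.Computability.FineGrained (NegTriToRadius.mul_add_eq_iff)
open Summit.Ventures.CertifiedManyBodySolver.Theorems.SymReplay

/-! ## (a) Letter codes inside the box `[lo, hi]` (pen's E4Spec §(a), verbatim) -/

/-- Row width of the box (number of `x 1` values). -/
def boxW (lo hi : ℤ × ℤ) : ℕ := (hi.2 - lo.2 + 1).toNat

/-- Lexicographic rank of a box site: `(a − lo.1)·W + (b − lo.2)`. -/
def siteRank (lo hi : ℤ × ℤ) (x : Site 2) : ℕ := (x 0 - lo.1).toNat * boxW lo hi + (x 1 - lo.2).toNat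

/-- **Packed letter**: `4·rank + 2·spin + (1 − dag)` — creators of a mode sort BEFORE its annihilators, as in `Letter.blt`. -/
def encL (lo hi : ℤ × ℤ) (ℓ : Letter) : ℕ := 4 * siteRank lo hi ℓ.x + 2 * ℓ.s.val + (if ℓ.dag then 0 else 1)

/-- Packed words and polynomials. -/
abbrev PWord := List ℕ

/-- Packed polynomials (coefficient, packed word). -/
abbrev PPoly := List (ℚ × PWord)

/-- Packed word (letter order kept). -/
def encW (lo hi : ℤ × ℤ) (w : Word) : PWord := w.map (encL lo hi)

/-- Packed polynomial (term order kept). -/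
def encP (lo hi : ℤ × ℤ) (p : QPoly) : PPoly := p.map fun t => (t.1, encW lo hi t.2)

/-! ## (b) Packed normal order and collector (hub-lb-sym-ref-1 `H_base.lean` (b) = pen's E4Spec §(b), verbatim) -/

/-- Dagger flag of a code (`true` = creation). -/
@[inline] def pdag (a : ℕ) : Bool := a % 2 == 0

/-- Same mode. -/
@[inline] def pmodeEq (a b : ℕ) : Bool := a / 2 == b / 2

/-- Mode order. -/
@[inline] def pmodeLt (a b : ℕ) : Bool := decide (a / 2 < b / 2)

/-- Equality of packed words. -/
def pwordEq : PWord → PWord → Bool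
  | [], [] => true
  | a :: u, b :: v => a == b && pwordEq u v
  | _, _ => false

/-- Lexicographic order of packed words (shorter prefix first). -/
def pwordLt : PWord → PWord → Bool
  | [], [] => false
  | [], _ :: _ => true
  | _ :: _, [] => false
  | a :: u, b :: v => decide (a < b) || (a == b && pwordLt u v)

/-- Prefix a code to every word, flipping signs. -/
def pconsNeg (m : ℕ) (p : PPoly) : PPoly := p.map fun t => (-t.1, m :: t.2)

/-- `insL` verbatim with packed comparisons. -/
def pinsL (ℓ : ℕ) : PWord → PPoly
  | [] => [(1, [ℓ])]
  | m :: rest =>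
    if pdag ℓ then
      if pdag m then
        if pmodeEq ℓ m then [] else if pmodeLt ℓ m then [(1, ℓ :: m :: rest)] else pconsNeg m (pinsL ℓ rest)
      else [(1, ℓ :: m :: rest)]
    else
      if pdag m then
        (if pmodeEq ℓ m then [((1 : ℚ), rest)] else []) ++ pconsNeg m (pinsL ℓ rest)
      else
        if pmodeEq ℓ m then [] else if pmodeLt ℓ m then [(1, ℓ :: m :: rest)] else pconsNeg m (pinsL ℓ rest)

/-- `nfWord` verbatim on packed words. -/
def pnfWord : PWord → PPoly
  | [] => [(1, [])]
  | ℓ :: w => (pnfWord w).flatMap fun t => (pinsL ℓ t.2).map fun t' => (t.1 * t'.1, t'.2)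

/-- Scalar multiple. -/
def ppscale (q : ℚ) (p : PPoly) : PPoly := p.map fun t => (q * t.1, t.2)

/-- `nfPoly` verbatim. -/
def pnfPoly (p : PPoly) : PPoly := p.flatMap fun t => ppscale t.1 (pnfWord t.2)

/-- Fuel-structural merge (= the tree's `mergeF` with `pwordLt`). -/
def pmergeF : ℕ → PPoly → PPoly → PPoly
  | 0, p, q => p ++ q
  | _ + 1, [], q => q
  | _ + 1, t :: p, [] => t :: p
  | n + 1, t :: p, t' :: q => if pwordLt t'.2 t.2 then t' :: pmergeF n (t :: p) q else t :: pmergeF n p (t' :: q)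

/-- One bottom-up round. -/
def pmergePairs (n : ℕ) : List PPoly → List PPoly
  | p :: q :: rest => pmergeF n p q :: pmergePairs n rest
  | l => l

/-- Merge-sort driver. -/
def pmergeAll : ℕ → ℕ → List PPoly → PPoly
  | _, _, [] => []
  | _, _, [p] => p
  | 0, _, l => l.foldr (· ++ ·) []
  | k + 1, n, l => pmergeAll k n (pmergePairs n l)

/-- Sort by `pwordLt` (stable). -/
def psortW (p : PPoly) : PPoly := pmergeAll p.length p.length (p.map fun t => [t])

/-- Merge adjacent equal words. -/
def pmergeAdj : PPoly → PPoly
  | [] => []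
  | t :: rest =>
    match pmergeAdj rest with
    | [] => [t]
    | t' :: rest' => if pwordEq t.2 t'.2 then (t.1 + t'.1, t.2) :: rest' else t :: t' :: rest'

/-- Packed collector (= `collect` = `mergeAdj ∘ sortW`). -/
def pcollect2 (p : PPoly) : PPoly := pmergeAdj (psortW p)

/-- Packed zero filter. -/
def pdropZeros (p : PPoly) : PPoly := p.filter fun t => !decide (t.1 = 0)

/-- Packed zero test. -/
def pisZero (p : PPoly) : Bool := (pcollect2 p).all fun t => decide (t.1 = 0)

/-! ## (c) The order isomorphism: code arithmetic -/

section Codes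

variable {lo hi : ℤ × ℤ}

/-- Mixed-radix comparison: with digits `j, j' < W`, `i·W + j < i'·W + j'` iff `(i, j) <ₗₑₓ (i', j')`. -/
theorem mixedRadix_lt {W i j i' j' : ℕ} (hj : j < W) (hj' : j' < W) :
    i * W + j < i' * W + j' ↔ i < i' ∨ (i = i' ∧ j < j') := by
  constructor
  · intro h
    rcases lt_trichotomy i i' with hlt | rfl | hgt
    · exact Or.inl hlt
    · exact Or.inr ⟨rfl, by omega⟩
    · exfalso
      have h1 : i' * W + W ≤ i * W := by
        have : (i' + 1) * W ≤ i * W := Nat.mul_le_mul_right W hgt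
        simpa [Nat.add_mul] using this
      omega
  · rintro (hlt | ⟨rfl, hjj⟩)
    · have h1 : i * W + W ≤ i' * W := by
        have : (i + 1) * W ≤ i' * W := Nat.mul_le_mul_right W hlt
        simpa [Nat.add_mul] using this
      omega
    · omega

/-! (Mixed-radix EQUALITY — digits and carries agree — is the landed
`Literature.Computability.FineGrained.NegTriToRadius.mul_add_eq_iff`, reused below.) -/

/-- The four box inequalities of a site, unfolded. -/
theorem inBoxSite_iff (x : Site 2) :
    inBoxSite lo hi x = true ↔ lo.1 ≤ x 0 ∧ x 0 ≤ hi.1 ∧ lo.2 ≤ x 1 ∧ x 1 ≤ hi.2 := by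
  simp [inBoxSite, Bool.and_eq_true, decide_eq_true_eq, and_assoc]

/-- The column digit of a box site is below the row width. -/
theorem colDigit_lt {x : Site 2} (hx : inBoxSite lo hi x = true) : (x 1 - lo.2).toNat < boxW lo hi := by
  rw [inBoxSite_iff] at hx
  unfold boxW
  omega

/-- Rank comparison IS the tree's lexicographic site order, inside the box. -/
theorem siteRank_lt_iff {x y : Site 2} (hx : inBoxSite lo hi x = true) (hy : inBoxSite lo hi y = true) :
    siteRank lo hi x < siteRank lo hi y ↔ x 0 < y 0 ∨ (x 0 = y 0 ∧ x 1 < y 1) := by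
  unfold siteRank
  rw [mixedRadix_lt (colDigit_lt hx) (colDigit_lt hy)]
  rw [inBoxSite_iff] at hx hy
  omega

/-- Rank equality IS coordinate equality, inside the box. -/
theorem siteRank_eq_iff {x y : Site 2} (hx : inBoxSite lo hi x = true) (hy : inBoxSite lo hi y = true) :
    siteRank lo hi x = siteRank lo hi y ↔ x 0 = y 0 ∧ x 1 = y 1 := by
  unfold siteRank
  rw [NegTriToRadius.mul_add_eq_iff (colDigit_lt hx) (colDigit_lt hy)]
  rw [inBoxSite_iff] at hx hy
  omega

/-- The mode code `2·rank + spin`. -/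
def mcode (lo hi : ℤ × ℤ) (ℓ : Letter) : ℕ := 2 * siteRank lo hi ℓ.x + ℓ.s.val

/-- `encL = 2·mcode + (1 − dag)`. -/
theorem encL_eq (ℓ : Letter) : encL lo hi ℓ = 2 * mcode lo hi ℓ + (if ℓ.dag then 0 else 1) := by
  unfold encL mcode; split_ifs <;> omega

/-- The half of a code is its mode code. -/
theorem encL_div_two (ℓ : Letter) : encL lo hi ℓ / 2 = mcode lo hi ℓ := by
  rw [encL_eq]; split <;> omega

/-- The parity of a code is its dagger flag. -/
theorem encL_mod_two (ℓ : Letter) : encL lo hi ℓ % 2 = (if ℓ.dag then 0 else 1) := by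
  rw [encL_eq]; split <;> omega

/-- **(a3-dag)** `pdag (encL ℓ) = ℓ.dag` (no box hypothesis). -/
theorem pdag_encL (ℓ : Letter) : pdag (encL lo hi ℓ) = ℓ.dag := by
  unfold pdag; rw [encL_mod_two]; cases ℓ.dag <;> rfl

/-- Mode-code comparison IS `Letter.modeLt`, inside the box. -/
theorem mcode_lt_iff {a b : Letter} (ha : inBoxSite lo hi a.x = true) (hb : inBoxSite lo hi b.x = true) :
    mcode lo hi a < mcode lo hi b ↔ a.modeLt b = true := by
  unfold mcode
  rw [mul_comm 2 (siteRank lo hi a.x), mul_comm 2 (siteRank lo hi b.x),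
    mixedRadix_lt a.s.isLt b.s.isLt, siteRank_lt_iff ha hb, siteRank_eq_iff ha hb, modeLt_iff]

/-- Mode-code equality IS `Letter.modeEq`, inside the box. -/
theorem mcode_eq_iff {a b : Letter} (ha : inBoxSite lo hi a.x = true) (hb : inBoxSite lo hi b.x = true) :
    mcode lo hi a = mcode lo hi b ↔ a.modeEq b = true := by
  unfold mcode
  rw [mul_comm 2 (siteRank lo hi a.x), mul_comm 2 (siteRank lo hi b.x),
    NegTriToRadius.mul_add_eq_iff a.s.isLt b.s.isLt, siteRank_eq_iff ha hb, modeEq_iff', Fin.val_inj]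

/-- **(a3-modeEq)** packed `pmodeEq` IS `Letter.modeEq` on box letters. -/
theorem pmodeEq_encL {a b : Letter} (ha : inBoxSite lo hi a.x = true) (hb : inBoxSite lo hi b.x = true) :
    pmodeEq (encL lo hi a) (encL lo hi b) = a.modeEq b := by
  unfold pmodeEq
  rw [encL_div_two, encL_div_two]
  rw [Bool.eq_iff_iff, beq_iff_eq, mcode_eq_iff ha hb]

/-- **(a3-modeLt)** packed `pmodeLt` IS `Letter.modeLt` on box letters. -/
theorem pmodeLt_encL {a b : Letter} (ha : inBoxSite lo hi a.x = true) (hb : inBoxSite lo hi b.x = true) :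
    pmodeLt (encL lo hi a) (encL lo hi b) = a.modeLt b := by
  unfold pmodeLt
  rw [encL_div_two, encL_div_two]
  rw [Bool.eq_iff_iff, decide_eq_true_eq, mcode_lt_iff ha hb]

/-- **(a3-beq)** code equality IS `Letter.beq` on box letters. -/
theorem beq_encL {a b : Letter} (ha : inBoxSite lo hi a.x = true) (hb : inBoxSite lo hi b.x = true) :
    (encL lo hi a == encL lo hi b) = a.beq b := by
  have hda : (if a.dag then 0 else 1) < 2 := by split <;> omega
  have hdb : (if b.dag then 0 else 1) < 2 := by split <;> omega
  rw [Bool.eq_iff_iff, beq_iff_eq, encL_eq, encL_eq, mul_comm 2 (mcode lo hi a), mul_comm 2 (mcode lo hi b),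
    NegTriToRadius.mul_add_eq_iff hda hdb, mcode_eq_iff ha hb]
  unfold Letter.beq
  cases a.modeEq b <;> cases a.dag <;> cases b.dag <;> simp

/-- **(a2)** the code is an ORDER ISOMORPHISM: `Letter.blt` IS `<` on box letters. -/
theorem blt_encL {a b : Letter} (ha : inBoxSite lo hi a.x = true) (hb : inBoxSite lo hi b.x = true) :
    decide (encL lo hi a < encL lo hi b) = a.blt b := by
  have hda : (if a.dag then 0 else 1) < 2 := by split <;> omega
  have hdb : (if b.dag then 0 else 1) < 2 := by split <;> omega
  rw [Bool.eq_iff_iff, decide_eq_true_eq, encL_eq, encL_eq, mul_comm 2 (mcode lo hi a), mul_comm 2 (mcode lo hi b),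
    mixedRadix_lt hda hdb, mcode_lt_iff ha hb, mcode_eq_iff ha hb]
  unfold Letter.blt
  cases a.modeLt b <;> cases a.modeEq b <;> cases a.dag <;> cases b.dag <;> simp

end Codes

end Summit.Ventures.CertifiedManyBodySolver.Theorems.SymReplay.PackedNF
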